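import Summits.ABC.ABC.Theses.DefiniteXi
import Summits.ABC.ABC.Theorems.DefiniteXiFreyModularityIsModular
import Summits.ABC.ABC.Theorems.DefiniteXiFreyModularityStubAbsIrrSqrtFive
import Summits.ABC.ABC.Theorems.DefiniteXiFreyModularityStubNineTransfer
import Summits.ABC.ABC.Theorems.DefiniteXiFreyModularityStubDegreeNeTwenty
import Literature.NumberTheory.Automorphic.CDTTheorem712ConductorStepProofs
import Literature.NumberTheory.EllipticCurves.SzpiroFreyCurveProofs
import HarnessLib

/-!
# Route DefiniteXi, crux `FreyModularity` (stmt-ABC-11340): the Frey-curve road of CDT's Theorem 7.1.2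

Line `Sketch` of the crux (`Summits/ABC/ABC/Cruxes/FreyModularity/Lines/Sketch.lean`), composed and
landed.  The crux is exactly "every Frey curve `E_(a,b) = freyCurve a b` (`a ⊥ b`, `ab(a+b) ≠ 0`) is
`BCDT.IsModular`" (`freyModularity_iff_forall_isModular_freyCurve`).  This file runs the printed proof of
Conrad–Diamond–Taylor 1999, Thm. 7.1.2 (JAMS 12, p. 556) on a Frey curve, with the Frey-specific
inputs PROVED in the tree:

* `9 ∤ N_E`, `25 ∤ N_E` (`not_nine_dvd_conductorNorm_freyCurve`, `not_twentyFive_dvd_conductorNorm_freyCurve`: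
  `N ∣ 2⁸ rad(ab(a+b))`);
* `ρ̄_{E,5}` irreducible — granted ONLY that no elliptic curve over `ℚ` has a rational cyclic
  `20`-isogeny (`X₀(20)(ℚ)` = cusps, Kubert 1976 / Kenku 1982): the landed
  `isIrreducible_freyCurve_five_of_degree_ne_twenty` (full rational `2`-torsion, Darmon–Merel 1997
  Thm. 2.2 road through `X₀(4p)`); alternatively granted the Mazur–Kenku classification
  (`isIrreducible_freyCurve_five_of_mazurKenku`, tree theorem
  `hasIrreducibleModPGaloisRep_freyCurve_of_mazurKenku`) — either REPLACING Elkies' Lemma 7.2.3 of CDT;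
* Rubin's Prop. 7: `25 ∤ N_E` and `ρ̄_{E,5}` irreducible ⇒ `ρ̄_{E,5}|_{ℚ(√5)}` absolutely irreducible
  (`stub_absIrrSqrtFive`, landed);
* Silverberg's Prop. 7.1 at `3`: `9 ∤ N_E` transfers along `E'[5] ≅ E[5]` (`stub_nineTransfer`, landed).

What remains are the modularity-lifting inputs, taken as hypotheses in the WEAKENED form the Frey
family needs (`isModular_freyCurve_of_lifts`, `freyModularity_of_lifts`: lifting at `3` only for
`9 ∤ N`, lifting at `5` only for `25 ∤ N` — Diamond 1996 / Diamond–Kramer 1995 technology — plus the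
Shepherd-Barron–Taylor switch and the irreducibility of `ρ̄_{E,5}` on Frey curves), and, for the record
of the route's trust base, with the lifting inputs as the tree's existing named facts:
`freyModularity_of_CDT721_CDT722_switch_degreeNeTwenty : CDT_theorem_7_2_1 → CDT_theorem_7_2_2 →
exists_isTorsionGaloisRep_five_and_surjective_three → (no cyclic 20-isogeny) → FreyModularity` and
`freyModularity_of_CDT721_CDT722_switch_mazurKenku` (Mazur–Kenku instead).  Compared with the closer
`freyModularity_of_CDT_theorem_7_1_2'` (trust base in the tree: CDT 7.2.1, 7.2.2, Lemma 7.2.3, the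
switch), Elkies' Lemma 7.2.3 is traded for `X₀(20)(ℚ)` = cusps, and the conductor hypotheses of the two
lifting theorems are only ever used at `9 ∤ N`, `25 ∤ N`.

## References

* B. Conrad, F. Diamond, R. Taylor, J. Amer. Math. Soc. 12 (1999), proof of Thm. 7.1.2 (p. 556).
* F. Diamond, K. Kramer, *Modularity of a family of elliptic curves*, Math. Res. Lett. 2 (1995) 299–304.
* K. Rubin, *Modularity of mod 5 representations*; A. Silverberg, *Explicit families of elliptic curves
  with prescribed mod N representations*, in Cornell–Silverman–Stevens (Springer 1997).
* H. Darmon, L. Merel, J. reine angew. Math. 490 (1997), Thm. 2.2; M. A. Kenku, J. Number Theory 15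
  (1982); B. Mazur, Invent. Math. 44 (1978), Thm. 1.
-/

-- `Summit.<Summit>.<Problem>` is the mandated summit-side namespace (CONVENTIONS §2); for the
-- single-conjunct summit `ABC` the two coincide, so the duplicate `ABC.ABC` is deliberate.
set_option linter.dupNamespace false

noncomputable section

open scoped MatrixGroups

open Literature.NumberTheory.EllipticCurves
open Literature.NumberTheory.Automorphic
open Literature.NumberTheory.Automorphic.BCDT
open Literature.NumberTheory.GaloisRepresentations
open WeierstrassCurve

namespace Summit.ABC.ABC.Theorems

/-- **The conductor of a Frey curve is not divisible by `25`.**  For coprime `a, b` with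
`ab(a+b) ≠ 0`, `N_{E_(a,b)} ∣ 2⁸ · rad(ab(a+b))` (`conductorNorm_freyCurve_dvd_holds`) and the radical
is squarefree, so `25 = 5 · 5` cannot divide `N`; i.e. every Frey curve is semistable at `5`.  Same
proof as `not_nine_dvd_conductorNorm_freyCurve`. [cite: BombieriGubler2006, Ex. 12.5.10] -/
theorem not_twentyFive_dvd_conductorNorm_freyCurve {a b : ℤ} (hab : IsCoprime a b)
    (h0 : a * b * (a + b) ≠ 0) : ¬ 25 ∣ (freyCurve a b).conductorNorm ℤ := by
  intro h25
  have hdvd := conductorNorm_freyCurve_dvd_holds a b hab h0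
  have h25' : 25 ∣ 2 ^ 8 * (UniqueFactorizationMonoid.radical (a * b * (a + b))).natAbs :=
    h25.trans hdvd
  have hcop : Nat.Coprime 25 (2 ^ 8) := by norm_num
  have h25r : 25 ∣ (UniqueFactorizationMonoid.radical (a * b * (a + b))).natAbs :=
    hcop.dvd_of_dvd_mul_left h25'
  have hsq : Squarefree (UniqueFactorizationMonoid.radical (a * b * (a + b))).natAbs :=
    Int.squarefree_natAbs.mpr UniqueFactorizationMonoid.squarefree_radical
  have h5 : IsUnit (5 : ℕ) := hsq 5 ((show (5 : ℕ) * 5 = 25 by norm_num) ▸ h25r)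
  exact absurd (Nat.isUnit_iff.mp h5) (by norm_num)

/-- **Frey rigidity at `5` (the Frey-family substitute for Elkies' CDT Lemma 7.2.3): every framed
model of `E_(a,b)[5]` is irreducible**, for `ab(a+b) ≠ 0`, granted the Mazur–Kenku fact.  The tree's
`hasIrreducibleModPGaloisRep_freyCurve_of_mazurKenku` (Darmon–Merel 1997, Thm. 2.2: the rational
`2`-torsion of `y² = x(x-a)(x+b)` and a `Γ_ℚ`-stable line in `E[5]` give a rational cyclic `20`-isogeny
on `E/⟨Q⟩`, and `20 ∉ kenkuDegrees`), transported to framed models by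
`BCDT.isIrreducible_of_hasIrreducibleModPGaloisRep`. [cite: DarmonMerel1997, Thm. 2.2] -/
theorem isIrreducible_freyCurve_five_of_mazurKenku (hMK : mazurKenku_exists_cyclic_isogeny)
    {a b : ℤ} (h0 : a * b * (a + b) ≠ 0) {ρ : ModPGaloisRep ℚ (ZMod 5) 2}
    (hρ : (freyCurve a b).IsTorsionGaloisRep 5 ρ) : FramedRep.IsIrreducible ρ :=
  isIrreducible_of_hasIrreducibleModPGaloisRep
    (hasIrreducibleModPGaloisRep_freyCurve_of_mazurKenku hMK h0 Nat.prime_five le_rfl) hρ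

/-- **Every Frey curve is modular, from the two SEMISTABLE lifting statements, the `3`–`5` switch and
the irreducibility of `ρ̄_{E,5}`** — CDT 1999, proof of Thm. 7.1.2 (p. 556), run on `E = E_(a,b)` (`a ⊥ b`, `ab(a+b) ≠ 0`):
`hlift9` = CDT Thm. 7.2.1 restricted to `9 ∤ N` (Langlands–Tunnell + Diamond 1996 Thm. 5.4),
`hlift25` = CDT Thm. 7.2.2 restricted to `25 ∤ N` (Diamond 1996 Thm. 5.3 at `ℓ = 5`), `hsw` = the
Shepherd-Barron–Taylor auxiliary curve, `hirr5` = irreducibility of `ρ̄_{E,5}` on Frey curves (from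
`X₀(20)` or from Mazur–Kenku, below).  Case A, some framed model of `E[3]` absolutely irreducible over
`ℚ(√-3)`: `hlift9` (`9 ∤ N`, `not_nine_dvd_conductorNorm_freyCurve`).  Case B: `ρ̄ = ρ̄_{E,5}` is
irreducible (`hirr5`), hence absolutely
irreducible over `ℚ(√5)` (`stub_absIrrSqrtFive`, `25 ∤ N`); its determinant is `χ̄₅` (Weil pairing,
`det_eq_modPCyclotomicCharacter_of_isTorsionGaloisRep_holds`), so the switch gives `E'` with
`E'[5] ≅ E[5]` and `ρ̄_{E',3}` surjective, hence absolutely irreducible over `ℚ(√-3)`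
(`isAbsIrreducibleOverSqrt_neg_three_of_surjective`); `9 ∤ N_{E'}` (`stub_nineTransfer`), so `E'` is
modular (`hlift9`), `ρ̄` is modular (`IsModular.isModular_of_isTorsionGaloisRep''`) and `E` is modular
(`hlift25`). [cite: ConradDiamondTaylor1999, Thm. 7.1.2 (proof, p. 556)] -/
theorem isModular_freyCurve_of_lifts
    (hlift9 : ∀ (W : WeierstrassCurve ℚ) [W.IsElliptic] [NeZero (W.conductorNorm ℤ)]
      (ρ : ModPGaloisRep ℚ (ZMod 3) 2), W.IsTorsionGaloisRep 3 ρ →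
      ρ.IsAbsIrreducibleOverSqrt (-3) → ¬ 9 ∣ W.conductorNorm ℤ → IsModular W)
    (hlift25 : ∀ (W : WeierstrassCurve ℚ) [W.IsElliptic] [NeZero (W.conductorNorm ℤ)],
      ¬ 25 ∣ W.conductorNorm ℤ →
      ∀ (ρ : ModPGaloisRep ℚ (ZMod 5) 2), W.IsTorsionGaloisRep 5 ρ →
      ρ.IsAbsIrreducibleOverSqrt 5 → ρ.IsModular → IsModular W)
    (hsw : exists_isTorsionGaloisRep_five_and_surjective_three)
    (hirr5 : ∀ a b : ℤ, IsCoprime a b → a * b * (a + b) ≠ 0 →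
      ∀ ρ : ModPGaloisRep ℚ (ZMod 5) 2, (freyCurve a b).IsTorsionGaloisRep 5 ρ →
        FramedRep.IsIrreducible ρ)
    {a b : ℤ} (hab : IsCoprime a b) (h0 : a * b * (a + b) ≠ 0)
    [NeZero ((freyCurve a b).conductorNorm ℤ)] : IsModular (freyCurve a b) := by
  haveI := isElliptic_freyCurve h0
  have h9 : ¬ 9 ∣ (freyCurve a b).conductorNorm ℤ := not_nine_dvd_conductorNorm_freyCurve hab h0
  have h25 : ¬ 25 ∣ (freyCurve a b).conductorNorm ℤ := not_twentyFive_dvd_conductorNorm_freyCurve hab h0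
  -- case A: some framed model of `E[3]` is absolutely irreducible over `ℚ(√-3)`
  by_cases hA : ∃ ρ₃ : ModPGaloisRep ℚ (ZMod 3) 2,
      (freyCurve a b).IsTorsionGaloisRep 3 ρ₃ ∧ ρ₃.IsAbsIrreducibleOverSqrt (-3)
  · obtain ⟨ρ₃, hρ₃, h3i⟩ := hA
    exact hlift9 (freyCurve a b) ρ₃ hρ₃ h3i h9
  -- case B: work at `5`
  obtain ⟨ρ, hρ⟩ := (freyCurve a b).exists_isTorsionGaloisRep 5
  have hirr : FramedRep.IsIrreducible ρ := hirr5 a b hab h0 ρ hρ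
  have h5 : ρ.IsAbsIrreducibleOverSqrt 5 := stub_absIrrSqrtFive (freyCurve a b) h25 ρ hρ hirr
  have hdet := (freyCurve a b).det_eq_modPCyclotomicCharacter_of_isTorsionGaloisRep_holds 5 ρ hρ
  -- the `3`–`5` switch
  obtain ⟨W', hW', hρ', ρ₃', hρ₃', hsurj⟩ := hsw ρ h5.isAbsolutelyIrreducible hdet
  haveI := hW'
  haveI : NeZero (W'.conductorNorm ℤ) := ⟨(conductorNorm_pos_holds W').ne'⟩
  -- `E'` is semistable at `3`, hence modular by the lifting theorem at `3`
  have h9' : ¬ 9 ∣ W'.conductorNorm ℤ := stub_nineTransfer (freyCurve a b) W' ρ hρ hρ' h9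
  have hE' : IsModular W' :=
    hlift9 W' ρ₃' hρ₃' (isAbsIrreducibleOverSqrt_neg_three_of_surjective ρ₃' hsurj) h9'
  -- so `ρ̄ = ρ̄_{E,5} = ρ̄_{E',5}` is modular, and `E` is modular by the lifting theorem at `5`
  have hρmod : ρ.IsModular := hE'.isModular_of_isTorsionGaloisRep'' hρ'
  exact hlift25 (freyCurve a b) h25 ρ hρ h5 hρmod

/-- **`FreyModularity` from the two semistable lifting statements, the switch and the irreducibility
of `ρ̄_{E,5}` on Frey curves** — the line `Sketch` of crux stmt-ABC-11340 composed:
`isModular_freyCurve_of_lifts` for every Frey curve, through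
`freyModularity_iff_forall_isModular_freyCurve`. [cite: ConradDiamondTaylor1999, Thm. 7.1.2 (proof, p. 556)] -/
theorem freyModularity_of_lifts
    (hlift9 : ∀ (W : WeierstrassCurve ℚ) [W.IsElliptic] [NeZero (W.conductorNorm ℤ)]
      (ρ : ModPGaloisRep ℚ (ZMod 3) 2), W.IsTorsionGaloisRep 3 ρ →
      ρ.IsAbsIrreducibleOverSqrt (-3) → ¬ 9 ∣ W.conductorNorm ℤ → IsModular W)
    (hlift25 : ∀ (W : WeierstrassCurve ℚ) [W.IsElliptic] [NeZero (W.conductorNorm ℤ)],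
      ¬ 25 ∣ W.conductorNorm ℤ →
      ∀ (ρ : ModPGaloisRep ℚ (ZMod 5) 2), W.IsTorsionGaloisRep 5 ρ →
      ρ.IsAbsIrreducibleOverSqrt 5 → ρ.IsModular → IsModular W)
    (hsw : exists_isTorsionGaloisRep_five_and_surjective_three)
    (hirr5 : ∀ a b : ℤ, IsCoprime a b → a * b * (a + b) ≠ 0 →
      ∀ ρ : ModPGaloisRep ℚ (ZMod 5) 2, (freyCurve a b).IsTorsionGaloisRep 5 ρ →
        FramedRep.IsIrreducible ρ) :
    Summit.ABC.ABC.Theses.DefiniteXi.FreyModularity :=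
  freyModularity_iff_forall_isModular_freyCurve.mpr
    fun _ _ hab h0 _ ↦ isModular_freyCurve_of_lifts hlift9 hlift25 hsw hirr5 hab h0

/-- **`FreyModularity` on the trust base {CDT Thm. 7.2.1, CDT Thm. 7.2.2, the SBT auxiliary curve,
`X₀(20)(ℚ)` = cusps}** — the composition with the lifting inputs taken as the tree's existing named
facts `BCDT.CDT_theorem_7_2_1` (`27 ∤ N` suffices for `9 ∤ N`) and `BCDT.CDT_theorem_7_2_2` (no
hypothesis at `5`), the switch as `BCDT.exists_isTorsionGaloisRep_five_and_surjective_three`, and the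
irreducibility of `ρ̄_{E,5}` from "no rational cyclic `20`-isogeny" (Kubert 1976 / Kenku 1982) by the
landed `isIrreducible_freyCurve_five_of_degree_ne_twenty`.  Compared with
`freyModularity_of_CDT_theorem_7_1_2'` (in-tree trust base CDT 7.2.1, 7.2.2, Lemma 7.2.3 and the
switch), Elkies' Lemma 7.2.3 is replaced by `X₀(20)`. [cite: ConradDiamondTaylor1999, Thm. 7.1.2 (proof, p. 556)] -/
theorem freyModularity_of_CDT721_CDT722_switch_degreeNeTwenty (h721 : CDT_theorem_7_2_1)
    (h722 : CDT_theorem_7_2_2) (hsw : exists_isTorsionGaloisRep_five_and_surjective_three)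
    (h20 : ∀ (W₁ W₂ : WeierstrassCurve ℚ) [W₁.IsElliptic] [W₂.IsElliptic] (φ : Isogeny W₁ W₂),
      φ.IsCyclic → φ.degree ≠ 20) : Summit.ABC.ABC.Theses.DefiniteXi.FreyModularity :=
  freyModularity_of_lifts
    (fun W _ _ ρ hρ h3 h9 ↦ h721 W ρ hρ h3 fun h27 ↦ h9 ((show (9 : ℕ) ∣ 27 by norm_num).trans h27))
    (fun W _ _ _ ρ hρ h5 hmod ↦ h722 W ρ hρ h5 hmod) hsw
    (isIrreducible_freyCurve_five_of_degree_ne_twenty h20)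

/-- **`FreyModularity` on the trust base {CDT Thm. 7.2.1, CDT Thm. 7.2.2, the SBT auxiliary curve,
Mazur–Kenku}** — as `freyModularity_of_CDT721_CDT722_switch_degreeNeTwenty`, with the irreducibility of
`ρ̄_{E,5}` on Frey curves taken from the Mazur–Kenku classification of rational cyclic isogenies
(`mazurKenku_exists_cyclic_isogeny`, `isIrreducible_freyCurve_five_of_mazurKenku`) — all four
hypotheses being named facts of the tree. [cite: ConradDiamondTaylor1999, Thm. 7.1.2 (proof, p. 556)] -/
theorem freyModularity_of_CDT721_CDT722_switch_mazurKenku (h721 : CDT_theorem_7_2_1)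
    (h722 : CDT_theorem_7_2_2) (hsw : exists_isTorsionGaloisRep_five_and_surjective_three)
    (hMK : mazurKenku_exists_cyclic_isogeny) : Summit.ABC.ABC.Theses.DefiniteXi.FreyModularity :=
  freyModularity_of_lifts
    (fun W _ _ ρ hρ h3 h9 ↦ h721 W ρ hρ h3 fun h27 ↦ h9 ((show (9 : ℕ) ∣ 27 by norm_num).trans h27))
    (fun W _ _ _ ρ hρ h5 hmod ↦ h722 W ρ hρ h5 hmod) hsw
    (fun _ _ _ h0 _ hρ ↦ isIrreducible_freyCurve_five_of_mazurKenku hMK h0 hρ)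

end Summit.ABC.ABC.Theorems

end
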